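import Summits.CriticalPhenomena.PercolationContinuityZ3.Theorems.PercNearOneGluingAdditiveGluingKnThm2Designated
import Summits.CriticalPhenomena.PercolationContinuityZ3.Theorems.PercNearOneGluingAdditiveGluingFullTieReduction
import HarnessLib

/-!
# Crux `PercNearOneGluing.AdditiveGluing` (stmt-CriticalPhenomena-4576): at the FULL tie, Kozma–Nitzan's Theorem 2 applies to EVERY
# designation — the three-relay stub reduces to the "all-bad" region `m₁ > m₂₃ ∧ m₂ > m₁₃ ∧ m₃ > m₁₂`

Support file (`--supports stmt-CriticalPhenomena-4576`, lead prim-png-lead-4576).  No definitions, no named facts, no sorries.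

With `m_S = μ(C(b) ∩ {a₁,a₂,a₃} = S)`, Kozma–Nitzan's Theorem 2 (landed at an arbitrary designation: `knThm2_designated'`, seat (d))
gives the Question-7 exchange `μ(o↔A ∩ a_j↔b) ≤ μ(o↔A ∩ o↔b)` for the designated relay `a_j` whenever `m_j ≤ m_{jᶜ}` and its
certificate is nonnegative; on the FULL tie `τ₁ = τ₂ = τ₃` (which is w.l.o.g. for the three-relay stub by `threeRelaysTieEform_of_fullTie`,
p175438) the certificate vanishes for every `j`, so any `j` with `m_j ≤ m_{jᶜ}` closes the E-form.  The degenerate case `μ(N_k) = 0`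
(`N_k = {a_k ↮ the other two}`) drops the relay `a_k` and is Kozma–Nitzan's Theorem 1 (landed `additiveGluing_twoRelays_eform_tie`).
**Theorem (`threeRelaysFullTieEform_of_allBad`).**  The full-tie three-relay stub `stub_threeRelaysFullTieEform_pl` follows from its
restriction to `μ(N₁), μ(N₂), μ(N₃) > 0` and `m₂₃ < m₁`, `m₁₃ < m₂`, `m₁₂ < m₃` (numerically ≈ 3 % of tied instances, lead lab t16).
[cite: KozmaNitzan2024, Theorem 2 (§3.2, pp. 8–9), Theorem 1 (§3.1), Question 7 (p. 36)]
-/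

namespace Summit.CriticalPhenomena.PercolationContinuityZ3.Theorems

open MeasureTheory Set Literature.Probability.LatticeModels Literature.Probability.Percolation

noncomputable section
open Classical

variable {n : ℕ}

/-- From the Question-7 exchange at a relay `x` with `1 − t ≤ μ(x↔b)` to the E-form `μ(o↔A ∖ o↔b) ≤ t`. [cite: KozmaNitzan2024, Question 7 (p. 36)] -/
theorem fullTie_eform_of_q7 (w : Sym2 (Fin n) → unitInterval) (OA : Set (BondConfig (Fin n))) (o b x : Fin n) (t : ℝ)
    (hq : (prodBernoulli w).real (OA ∩ openConn x b) ≤ (prodBernoulli w).real (OA ∩ openConn o b))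
    (ht : 1 - t ≤ (prodBernoulli w).real (openConn x b)) :
    (prodBernoulli w).real (OA \ openConn o b) ≤ t := by
  have hm : ∀ s : Set (BondConfig (Fin n)), MeasurableSet s := fun _ => MeasurableSet.of_discrete
  have h1 := measureReal_inter_add_sdiff (μ := prodBernoulli w) (s := OA) (hm (openConn o b))
  have h2 := measureReal_inter_add_sdiff (μ := prodBernoulli w) (s := OA) (hm (openConn x b))
  have h3 : (prodBernoulli w).real (OA \ openConn x b) ≤ (prodBernoulli w).real ((openConn x b)ᶜ : Set (BondConfig (Fin n))) :=
    measureReal_mono (fun ω hω => hω.2) (measure_ne_top _ _)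
  have h4 : (prodBernoulli w).real ((openConn x b)ᶜ : Set (BondConfig (Fin n))) = 1 - (prodBernoulli w).real (openConn x b) :=
    probReal_compl_eq_one_sub (hm _)
  linarith

/-- Dropping a relay that is a.s. attached to the others: `μ(o↔x ∖ (o↔y ∪ o↔z)) ≤ μ(x↮y, x↮z)`. [folklore] -/
theorem fullTie_drop_relay (w : Sym2 (Fin n) → unitInterval) (o x y z : Fin n) :
    (prodBernoulli w).real ((openConn o x : Set (BondConfig (Fin n))) \ (openConn o y ∪ openConn o z)) ≤
      (prodBernoulli w).real ((openConn x y)ᶜ ∩ (openConn x z)ᶜ : Set (BondConfig (Fin n))) := by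
  refine measureReal_mono (fun ω hω => ?_) (measure_ne_top _ _)
  rcases hω with ⟨hx, hyz⟩
  simp only [Set.mem_union, not_or] at hyz
  constructor
  · intro hxy; exact hyz.1 (SimpleGraph.Reachable.trans hx hxy)
  · intro hxz; exact hyz.2 (SimpleGraph.Reachable.trans hx hxz)

/-- The E-form after dropping relay `x` (null separation event) reduces to the two-relay E-form for `{y, z}`. [folklore] -/
theorem fullTie_eform_drop (w : Sym2 (Fin n) → unitInterval) (o b x y z : Fin n) (t : ℝ)
    (hnull : (prodBernoulli w).real ((openConn x y)ᶜ ∩ (openConn x z)ᶜ : Set (BondConfig (Fin n))) = 0)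
    (hyz : (prodBernoulli w).real (openConn z b) ≤ (prodBernoulli w).real (openConn y b))
    (ht : 1 - t ≤ (prodBernoulli w).real (openConn z b)) :
    (prodBernoulli w).real ((openConn o x ∪ openConn o y ∪ openConn o z) \ openConn o b : Set (BondConfig (Fin n))) ≤ t := by
  have hm : ∀ s : Set (BondConfig (Fin n)), MeasurableSet s := fun _ => MeasurableSet.of_discrete
  have h2 := additiveGluing_twoRelays_eform_tie w o b y z hyz
  have hc : (prodBernoulli w).real ((openConn z b)ᶜ : Set (BondConfig (Fin n))) = 1 - (prodBernoulli w).real (openConn z b) :=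
    probReal_compl_eq_one_sub (hm _)
  have hsub : ((openConn o x ∪ openConn o y ∪ openConn o z) \ openConn o b : Set (BondConfig (Fin n))) ⊆
      ((openConn o y ∪ openConn o z) \ openConn o b) ∪ (openConn o x \ (openConn o y ∪ openConn o z)) := by
    intro ω hω
    rcases hω with ⟨hA, hb⟩
    by_cases hyz' : ω ∈ (openConn o y ∪ openConn o z : Set (BondConfig (Fin n)))
    · exact Or.inl ⟨hyz', hb⟩
    · rcases hA with (hx | hy) | hz
      · exact Or.inr ⟨hx, hyz'⟩
      · exact absurd (Or.inl hy) hyz'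
      · exact absurd (Or.inr hz) hyz'
  have hle := (measureReal_mono hsub (measure_ne_top (prodBernoulli w) _)).trans
    (measureReal_union_le ((openConn o y ∪ openConn o z) \ openConn o b) (openConn o x \ (openConn o y ∪ openConn o z)))
  have hd := fullTie_drop_relay w o x y z
  linarith

/-- **At the full tie the three-relay E-form reduces to the all-bad region** (see the file header).
[cite: KozmaNitzan2024, Theorem 2 (§3.2, pp. 8–9), Theorem 1 (§3.1)] -/
theorem threeRelaysFullTieEform_of_allBad
    (hbad : ∀ (n : ℕ) (w : Sym2 (Fin n) → unitInterval) (o b a₁ a₂ a₃ : Fin n) (t : ℝ),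
      a₁ ≠ a₂ → a₁ ≠ a₃ → a₂ ≠ a₃ →
      1 - t ≤ (prodBernoulli w).real (openConn a₃ b) →
      (prodBernoulli w).real (openConn a₃ b) ≤ (prodBernoulli w).real (openConn a₁ b) →
      (prodBernoulli w).real (openConn a₃ b) ≤ (prodBernoulli w).real (openConn a₂ b) →
      (prodBernoulli w).real (openConn a₁ b) ≤ (prodBernoulli w).real (openConn a₃ b) →
      (prodBernoulli w).real (openConn a₂ b) ≤ (prodBernoulli w).real (openConn a₃ b) →
      0 < (prodBernoulli w).real ((openConn a₁ a₂)ᶜ ∩ (openConn a₁ a₃)ᶜ : Set (BondConfig (Fin n))) →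
      0 < (prodBernoulli w).real ((openConn a₂ a₁)ᶜ ∩ (openConn a₂ a₃)ᶜ : Set (BondConfig (Fin n))) →
      0 < (prodBernoulli w).real ((openConn a₁ a₃)ᶜ ∩ (openConn a₂ a₃)ᶜ : Set (BondConfig (Fin n))) →
      (prodBernoulli w).real (openConn b a₂ ∩ openConn b a₃ ∩ (openConn b a₁)ᶜ) <
        (prodBernoulli w).real (openConn b a₁ ∩ (openConn b a₂)ᶜ ∩ (openConn b a₃)ᶜ) →
      (prodBernoulli w).real (openConn b a₁ ∩ openConn b a₃ ∩ (openConn b a₂)ᶜ) <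
        (prodBernoulli w).real (openConn b a₂ ∩ (openConn b a₁)ᶜ ∩ (openConn b a₃)ᶜ) →
      (prodBernoulli w).real (openConn b a₁ ∩ openConn b a₂ ∩ (openConn b a₃)ᶜ) <
        (prodBernoulli w).real (openConn b a₃ ∩ (openConn b a₁)ᶜ ∩ (openConn b a₂)ᶜ) →
      (prodBernoulli w).real ((openConn o a₁ ∪ openConn o a₂ ∪ openConn o a₃) \ openConn o b) ≤ t) :
    ∀ (n : ℕ) (w : Sym2 (Fin n) → unitInterval) (o b a₁ a₂ a₃ : Fin n) (t : ℝ),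
      a₁ ≠ a₂ → a₁ ≠ a₃ → a₂ ≠ a₃ →
      1 - t ≤ (prodBernoulli w).real (openConn a₃ b) →
      (prodBernoulli w).real (openConn a₃ b) ≤ (prodBernoulli w).real (openConn a₁ b) →
      (prodBernoulli w).real (openConn a₃ b) ≤ (prodBernoulli w).real (openConn a₂ b) →
      (prodBernoulli w).real (openConn a₁ b) ≤ (prodBernoulli w).real (openConn a₃ b) →
      (prodBernoulli w).real (openConn a₂ b) ≤ (prodBernoulli w).real (openConn a₃ b) →
      (prodBernoulli w).real ((openConn o a₁ ∪ openConn o a₂ ∪ openConn o a₃) \ openConn o b) ≤ t := by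
  intro n w o b a₁ a₂ a₃ t h12 h13 h23 ht h31 h32 h13' h23'
  have hτ1 : (prodBernoulli w).real (openConn a₁ b) = (prodBernoulli w).real (openConn a₃ b) := le_antisymm h13' h31
  have hτ2 : (prodBernoulli w).real (openConn a₂ b) = (prodBernoulli w).real (openConn a₃ b) := le_antisymm h23' h32
  have ht1 : 1 - t ≤ (prodBernoulli w).real (openConn a₁ b) := by rw [hτ1]; exact ht
  have ht2 : 1 - t ≤ (prodBernoulli w).real (openConn a₂ b) := by rw [hτ2]; exact ht
  set OA : Set (BondConfig (Fin n)) := openConn o a₁ ∪ openConn o a₂ ∪ openConn o a₃ with hOA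
  -- orientation bookkeeping for the separation events
  have c21 : (openConn a₂ a₁ : Set (BondConfig (Fin n))) = openConn a₁ a₂ := knThm2_openConn_comm a₂ a₁
  have c31 : (openConn a₃ a₁ : Set (BondConfig (Fin n))) = openConn a₁ a₃ := knThm2_openConn_comm a₃ a₁
  have c32 : (openConn a₃ a₂ : Set (BondConfig (Fin n))) = openConn a₂ a₃ := knThm2_openConn_comm a₃ a₂
  -- degenerate cases: a relay a.s. attached to the others
  by_cases hN1 : (prodBernoulli w).real ((openConn a₁ a₂)ᶜ ∩ (openConn a₁ a₃)ᶜ : Set (BondConfig (Fin n))) = 0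
  · -- drop a₁: E-form for {a₂, a₃}
    have h := fullTie_eform_drop w o b a₁ a₂ a₃ t hN1 h32 ht
    simpa [hOA] using h
  by_cases hN2 : (prodBernoulli w).real ((openConn a₂ a₁)ᶜ ∩ (openConn a₂ a₃)ᶜ : Set (BondConfig (Fin n))) = 0
  · -- drop a₂: E-form for {a₁, a₃}
    have h := fullTie_eform_drop w o b a₂ a₁ a₃ t hN2 h31 ht
    have hU : (openConn o a₂ ∪ openConn o a₁ ∪ openConn o a₃ : Set (BondConfig (Fin n))) = OA := by
      rw [hOA]; ext ω; simp only [Set.mem_union]; tauto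
    rw [hU] at h; exact h
  by_cases hN3 : (prodBernoulli w).real ((openConn a₁ a₃)ᶜ ∩ (openConn a₂ a₃)ᶜ : Set (BondConfig (Fin n))) = 0
  · -- drop a₃: E-form for {a₁, a₂} (τ₂ ≤ τ₁ after the tie)
    have hN3' : (prodBernoulli w).real ((openConn a₃ a₁)ᶜ ∩ (openConn a₃ a₂)ᶜ : Set (BondConfig (Fin n))) = 0 := by
      rw [c31, c32]; exact hN3
    have h21 : (prodBernoulli w).real (openConn a₂ b) ≤ (prodBernoulli w).real (openConn a₁ b) := by rw [hτ1, hτ2]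
    have h := fullTie_eform_drop w o b a₃ a₁ a₂ t hN3' h21 ht2
    have hU : (openConn o a₃ ∪ openConn o a₁ ∪ openConn o a₂ : Set (BondConfig (Fin n))) = OA := by
      rw [hOA]; ext ω; simp only [Set.mem_union]; tauto
    rw [hU] at h; exact h
  have hP1 : 0 < (prodBernoulli w).real ((openConn a₁ a₂)ᶜ ∩ (openConn a₁ a₃)ᶜ : Set (BondConfig (Fin n))) :=
    lt_of_le_of_ne measureReal_nonneg (Ne.symm hN1)
  have hP2 : 0 < (prodBernoulli w).real ((openConn a₂ a₁)ᶜ ∩ (openConn a₂ a₃)ᶜ : Set (BondConfig (Fin n))) :=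
    lt_of_le_of_ne measureReal_nonneg (Ne.symm hN2)
  have hP3 : 0 < (prodBernoulli w).real ((openConn a₁ a₃)ᶜ ∩ (openConn a₂ a₃)ᶜ : Set (BondConfig (Fin n))) :=
    lt_of_le_of_ne measureReal_nonneg (Ne.symm hN3)
  -- Kozma–Nitzan Theorem 2 at the designation a₃ / a₁ / a₂ (certificate = 0 on the full tie)
  by_cases hg3 : (prodBernoulli w).real (openConn b a₃ ∩ (openConn b a₁)ᶜ ∩ (openConn b a₂)ᶜ) ≤
      (prodBernoulli w).real (openConn b a₁ ∩ openConn b a₂ ∩ (openConn b a₃)ᶜ)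
  · have hq := knThm2_designated' w o b a₁ a₂ a₃ h12 h13 h23 hP3 hP1 hP2 (by rw [hτ1, hτ2]; simp) hg3
    exact fullTie_eform_of_q7 w OA o b a₃ t hq ht
  by_cases hg1 : (prodBernoulli w).real (openConn b a₁ ∩ (openConn b a₂)ᶜ ∩ (openConn b a₃)ᶜ) ≤
      (prodBernoulli w).real (openConn b a₂ ∩ openConn b a₃ ∩ (openConn b a₁)ᶜ)
  · -- designation a₁: relabel (a₁,a₂,a₃) ↦ (a₂,a₃,a₁)
    have hP3' : 0 < (prodBernoulli w).real ((openConn a₂ a₁)ᶜ ∩ (openConn a₃ a₁)ᶜ : Set (BondConfig (Fin n))) := by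
      rw [c21, c31]; exact hP1
    have hP1' : 0 < (prodBernoulli w).real ((openConn a₂ a₃)ᶜ ∩ (openConn a₂ a₁)ᶜ : Set (BondConfig (Fin n))) := by
      rw [Set.inter_comm]; exact hP2
    have hP2' : 0 < (prodBernoulli w).real ((openConn a₃ a₂)ᶜ ∩ (openConn a₃ a₁)ᶜ : Set (BondConfig (Fin n))) := by
      rw [c32, c31, Set.inter_comm]; exact hP3
    have hq := knThm2_designated' w o b a₂ a₃ a₁ h23 (Ne.symm h12) (Ne.symm h13) hP3' hP1' hP2' (by rw [hτ1, hτ2]; simp) hg1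
    have hU : (openConn o a₂ ∪ openConn o a₃ ∪ openConn o a₁ : Set (BondConfig (Fin n))) = OA := by
      rw [hOA]; ext ω; simp only [Set.mem_union]; tauto
    rw [hU] at hq
    exact fullTie_eform_of_q7 w OA o b a₁ t hq ht1
  by_cases hg2 : (prodBernoulli w).real (openConn b a₂ ∩ (openConn b a₁)ᶜ ∩ (openConn b a₃)ᶜ) ≤
      (prodBernoulli w).real (openConn b a₁ ∩ openConn b a₃ ∩ (openConn b a₂)ᶜ)
  · -- designation a₂: relabel (a₁,a₂,a₃) ↦ (a₁,a₃,a₂)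
    have hP3' : 0 < (prodBernoulli w).real ((openConn a₁ a₂)ᶜ ∩ (openConn a₃ a₂)ᶜ : Set (BondConfig (Fin n))) := by
      rw [c32, ← c21]; exact hP2
    have hP1' : 0 < (prodBernoulli w).real ((openConn a₁ a₃)ᶜ ∩ (openConn a₁ a₂)ᶜ : Set (BondConfig (Fin n))) := by
      rw [Set.inter_comm]; exact hP1
    have hP2' : 0 < (prodBernoulli w).real ((openConn a₃ a₁)ᶜ ∩ (openConn a₃ a₂)ᶜ : Set (BondConfig (Fin n))) := by
      rw [c31, c32]; exact hP3
    have hq := knThm2_designated' w o b a₁ a₃ a₂ h13 h12 (Ne.symm h23) hP3' hP1' hP2' (by rw [hτ1, hτ2]; simp) hg2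
    have hU : (openConn o a₁ ∪ openConn o a₃ ∪ openConn o a₂ : Set (BondConfig (Fin n))) = OA := by
      rw [hOA]; ext ω; simp only [Set.mem_union]; tauto
    rw [hU] at hq
    exact fullTie_eform_of_q7 w OA o b a₂ t hq ht2
  -- all three designations bad: the residual hypothesis
  push Not at hg1 hg2 hg3
  exact hbad n w o b a₁ a₂ a₃ t h12 h13 h23 ht h31 h32 h13' h23' hP1 hP2 hP3 hg1 hg2 hg3

end

end Summit.CriticalPhenomena.PercolationContinuityZ3.Theorems
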